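import Summits.HodgeConjecture.HodgeConjecture.Theorems.Ring2AbelianAllWeilFloorLandherr
import Literature.AlgebraicGeometry.Milne1999.CMTypeSimpleIsogenyFactors
import HarnessLib

/-!
# Ring 2 · AbelianAll (ab-weil-1, gen 9, part 7) — the MINIMAL moduli leaf of a cell is ANCHOR-POINTED:
  `IsogenyConnectedToCMAnchor n d δ` (each member is joined, up to isogeny at the far end, to the CM tower),
  between gen 8's `IsogenyConnectedWeilComponent` and gen 5's pointed leaves, valid WITHOUT `HC_CM`

research route, not a corollary; conditional on HC_CM plus one named minimal statement.
Cell line: research route conditional on HC_CM; not a corollary; Q11.4-sentence-2 already refuted in dim ≥ 3.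
`HC_CM` (`Theses.RankFourFaces.CMAbelianHodge`) does not occur in this file. What is proved about the Hodge
conjecture here is, as in part 4, only Tate's theorem for abelian varieties ISOGENOUS to one generated by a single CM
elliptic curve (van Geemen Lemma 3.7 + Thm. 4.3, in the tree:
`EllipticCurve.hodgeConjectureFor_of_isIsogenous_of_hodgeOneZero_mem_span_pullback`) — nothing about a general member
of a cell; no cycle is constructed.

WHY THIS FILE (referee F-ref2-61, LEAD L20.3 (iii): "N72 quantifies the far end over ALL exact-δ members; the rows
use it only at the CM anchor — an anchor-pointed node would be the MINIMAL statement"). Part 4 typed the residual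
moduli leaf of a cell `(n, d, δ)` as `IsogenyConnectedWeilComponent n d δ` (N72: ANY two polarized members of the
component are joined, up to an isogeny at one end, by a `(ℚ(√-d), 2n, δ)`-Weil family carrying the class). The rows
of part 4 apply it with the far end THE CM TOWER of the cell (`exists_cmMember`: a member of exact class `δ` generated
by one curve `E₀ = ℂ/ℤ[√-d]`, of CM type, on which HC holds by Tate). This file types exactly what the rows consume:

* `cmTowerAnchor n d` — anchor predicate: the marked fibre is charted by an abelian `2n`-fold ISOGENOUS to a CM
  abelian variety `B` whose `(1,0)`-classes are pulled back from ONE elliptic curve `E₀` with `ψ₀² = -d`;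
  VALID WITHOUT `HC_CM` (`cmTowerAnchor_valid`: Tate up to isogeny) and a CM anchor (`cmAnchor_of_cmTowerAnchor`,
  CM type is an isogeny invariant, `Milne1999.isOfCMType_iff_of_isIsogenous`);
* `IsogenyConnectedToCMAnchor n d δ := PointedWeilFamiliesComponent n d δ (cmTowerAnchor n d)` (N73, typed missing
  input, a MODULI statement, NOT a case of HC, NOT a Literature fact): every polarized member of the component carrying
  a non-zero rational `(n,n)` Weil class is joined, by a smooth projective `(ℚ(√-d), 2n, δ)`-Weil family over a smooth
  irreducible quasi-projective base carrying the class, to a fibre charted up to isogeny by the CM tower.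

THE IMPLICATION GRAPH (all kernel, all `n, d ≥ 1`, every `δ`):
`IsogenyConnectedWeilComponent ⟹ IsogenyConnectedToCMAnchor` (`…_of_isogenyConnected`; right sign: feed N72 the CM
tower; wrong sign: both vacuous, part 5) `⟹ CMPointedWeilFamiliesComponent` (gen 5's `HC_CM`-using leaf;
`cmPointedWeilFamiliesComponent_of_isogenyConnectedToCMAnchor`) and `⟹ AnchoredWeilFamiliesComponent` (R∞anc(δ),
`HC_CM`-FREE; `anchoredWeilFamiliesComponent_of_isogenyConnectedToCMAnchor`); hence
**`WeilClassesComponent n d δ ⟸ IsogenyConnectedToCMAnchor n d δ ∧ WeilVariationalHodgeComponent n d δ`** for EVERY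
cell, with no sign hypothesis and no `HC_CM` (`weilClassesComponent_of_isogenyConnectedToCMAnchor_of_variational`),
the column (`weilClassesByComponent_of_anchorPointed_of_variational`) and the dim `≤ 5` floor on four refereed facts
plus, per positive non-split squarefree fourfold cell, `IsogenyConnectedToCMAnchor 2 d₀ δ ∧ VHC(2, d₀, δ)`
(`hodgeConjectureFor_abelian_dim_le_five_of_refereed_anchorPointed_variational_L`). So the per-cell residual of the
Weil column is now: ONE anchor-pointed moduli statement (in print: van Geemen 5.3, 5.8–5.11 — the connected
`n²`-dimensional family `H_n/Γ_Λ` through any polarized triple —, Landherr's classification of `K`-Hermitian forms to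
place the CM tower's `(V, H)` isometrically, Deligne's théorème de la partie fixe for the global class, Baily–Borel;
Deligne 1982 proof of Thm. 4.8: every member of the family is joined to CM members) plus ONE instance of Grothendieck's
variational Hodge conjecture — and among the typed moduli candidates N73 is implied by N72 and implies gen 5's
CM-pointed leaf, the only one of the three that is both `HC_CM`-free in the kernel and pointed at a NAMED member.

## References
* B. van Geemen, *An introduction to the Hodge conjecture for abelian varieties*, LNM 1594 (1994), Lemma 3.7,
  Thm. 4.3, 4.11, 4.14, Lemma 5.2, 5.3–5.5, 5.8–5.11. [vanGeemen1994HodgeAV]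
* P. Deligne, *Hodge cycles on abelian varieties*, LNM 900 (1982), §4, proof of Thm. 4.8 (a)–(c), §5. [Deligne1982HodgeCycles]
* J. S. Milne, *Lefschetz motives and the Tate conjecture*, Compositio Math. 117 (1999), §2 p. 54. [Milne1999]
* E. Markman, arXiv:2502.03415 (2025), p. 3 and Thm. 1.5.1 (preprint, unrefereed). [Markman2025SecantWeil]
* F. Charles, C. Schnell, *Notes on absolute Hodge classes* (2014), Conj. 11.3.1. [CharlesSchnell2014Notes]
* B. Moonen, Yu. Zarhin, *Hodge classes on abelian varieties of low dimension*, Math. Ann. 315 (1999), Thm. 0.1. [MoonenZarhin1999]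
-/

noncomputable section

set_option linter.dupNamespace false

open CategoryTheory MonoidalCategory AlgebraicGeometry
open Literature.AlgebraicGeometry Literature.AlgebraicGeometry.Motives
open Literature.AlgebraicGeometry.Motives.SegreHyperplaneClass
open Literature.AlgebraicGeometry.HodgeTheory
open Literature.AlgebraicGeometry.Milne1999 (IsOfCMType)
open Literature.AlgebraicGeometry.VanGeemen1994
open Literature.AlgebraicTopology.SingularHomology
open Summit.HodgeConjecture.HodgeConjecture.Ring2.Hypotheses

namespace Summit.HodgeConjecture.HodgeConjecture.Ring2.AbelianAll

/-! ### §1 The CM-tower anchor: valid WITHOUT `HC_CM`, and a CM anchor -/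

/-- **`cmTowerAnchor n d X x` — the marked fibre is charted, up to isogeny, by the CM tower of the cell.** There is
an abelian `2n`-fold `A'` with `A'.X ≅ X`, isogenous to a CM abelian variety `B` all of whose `(1,0)`-classes are
`ℂ`-combinations of pull-backs `g^*w` of `(1,0)`-classes of ONE elliptic curve `E₀` with `ψ₀ ≫ ψ₀ = -d` (the members
`E₀ⁿ × E₀ⁿ` of van Geemen 5.3 / the tower of part 4, in any bracketing, and everything isogenous to them). The class
`x` is not constrained by the predicate (as for gen 5's `cmAnchor`). [cite: vanGeemen1994HodgeAV, Thm. 4.3 and 5.3]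
[cite: Deligne1982HodgeCycles, §4, proof of Thm. 4.8 (a)–(c)] -/
def cmTowerAnchor (n d : ℕ) (X : SchemeOver ℂ) (_x : complexBetti X (2 * n)) : Prop :=
  ∃ A' : AbelianVariety ℂ, Nonempty (A'.X ≅ X) ∧ A'.dim = 2 * n ∧
    ∃ (E₀ : AbelianVariety ℂ) (ψ₀ : E₀ ⟶ E₀) (B : AbelianVariety ℂ), E₀.dim = 1 ∧ ψ₀ ≫ ψ₀ = -(d • 𝟙 E₀) ∧
      A'.IsIsogenous B ∧ IsOfCMType B ∧
      ∀ u : complexBetti B.X 1, IsOfHodgeType B.dim B.X 1 1 0 u →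
        u ∈ Submodule.span ℂ {y : complexBetti B.X 1 | ∃ (g : B ⟶ E₀) (w : complexBetti E₀.X 1),
          IsOfHodgeType E₀.dim E₀.X 1 1 0 w ∧ y = complexBetti.map g.hom.hom.hom 1 w}

/-- **The CM-tower anchor is VALID WITHOUT `HC_CM`**: a rational `(n,n)` class on a fibre charted up to isogeny by the
CM tower is algebraic — transport to the chart `A'`, where the Hodge conjecture holds by Tate's theorem up to isogeny
(van Geemen Lemma 3.7 + Thm. 4.3; tree: `EllipticCurve.hodgeConjectureFor_of_isIsogenous_of_hodgeOneZero_mem_span_pullback`),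
and transport back. UNCONDITIONAL. [cite: vanGeemen1994HodgeAV, Lemma 3.7 and Thm. 4.3] -/
theorem cmTowerAnchor_valid (n : ℕ) {d : ℕ} (hd : 0 < d) :
    ∀ (X : SchemeOver ℂ) (x : complexBetti X (2 * n)), cmTowerAnchor n d X x → IsRationalClass x →
      IsOfHodgeType (2 * n) X (2 * n) n n x → x ∈ algebraicClasses X n := by
  rintro X x ⟨A', ⟨e'⟩, hA'dim, E₀, ψ₀, B, hE, hψ, hiso, -, hgen⟩ hxQ hxH
  have hHC : HodgeConjectureFor A'.dim A'.X :=
    EllipticCurve.hodgeConjectureFor_of_isIsogenous_of_hodgeOneZero_mem_span_pullback hE ψ₀ hd hψ hiso hgen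
  have hx' : complexBetti.map e'.hom (2 * n) x ∈ algebraicClasses A'.X n := by
    refine hHC.2 n _ ((isRationalClass_map_iff_of_iso e').2 hxQ) ?_
    rw [hA'dim]
    exact (isOfHodgeType_map_iff_of_iso e').2 hxH
  exact (mem_algebraicClasses_map_iff_of_iso e').1 hx'

/-- **The CM-tower anchor is a CM anchor** (gen 5's `cmAnchor`): CM type is an isogeny invariant
(`Milne1999.isOfCMType_iff_of_isIsogenous`, Mumford §19). [cite: Milne1999, §2 p. 54] -/
theorem cmAnchor_of_cmTowerAnchor {n d : ℕ} {X : SchemeOver ℂ} {x : complexBetti X (2 * n)}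
    (h : cmTowerAnchor n d X x) : cmAnchor n X x := by
  obtain ⟨A', he', hA'dim, E₀, ψ₀, B, -, -, hiso, hB, -⟩ := h
  exact ⟨A', he', hA'dim, (Milne1999.isOfCMType_iff_of_isIsogenous hiso).2 hB⟩

/-- **The CM tower of part 4 meets the CM-tower anchor on its own fibre**: a member `A` of the tower (generated by
`E₀`, of CM type, `dim A = 2n`) charts `A.X` by the identity. [cite: vanGeemen1994HodgeAV, 5.3] -/
theorem cmTowerAnchor_self {n d : ℕ} {A E₀ : AbelianVariety ℂ} {ψ₀ : E₀ ⟶ E₀} (hA : A.dim = 2 * n)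
    (hE : E₀.dim = 1) (hψ : ψ₀ ≫ ψ₀ = -(d • 𝟙 E₀)) (hcm : IsOfCMType A)
    (hgen : ∀ u : complexBetti A.X 1, IsOfHodgeType A.dim A.X 1 1 0 u →
      u ∈ Submodule.span ℂ {y : complexBetti A.X 1 | ∃ (g : A ⟶ E₀) (w : complexBetti E₀.X 1),
        IsOfHodgeType E₀.dim E₀.X 1 1 0 w ∧ y = complexBetti.map g.hom.hom.hom 1 w})
    (x : complexBetti A.X (2 * n)) : cmTowerAnchor n d A.X x :=
  ⟨A, ⟨Iso.refl _⟩, hA, E₀, ψ₀, A, hE, hψ, AbelianVariety.IsIsogenous.refl A, hcm, hgen⟩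

/-! ### §2 The anchor-pointed moduli leaf `IsogenyConnectedToCMAnchor` (N73) -/

/-- **`IsogenyConnectedToCMAnchor n d δ` — every polarized member of the component `(ℚ(√-d), 2n, δ)` is joined, up to
isogeny at the far end, to the CM TOWER of the cell (typed missing input; a MODULI statement, NOT a case of HC, NOT a
Literature fact; the MINIMAL form of part 4's `IsogenyConnectedWeilComponent`).** For `(A, φ, h_K = d·e^*a + φ^*e^*a)`
of exact discriminant class `δ` and a non-zero rational `(n,n)` Weil class `c` on `A`: a smooth projective
`(ℚ(√-d), 2n, δ)`-Weil family `f : 𝒳 ⟶ S` (`𝒳`, `S` quasi-projective, `S` smooth irreducible) with a global class `W`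
fibrewise rational of type `(n,n)`, a fibre `𝒳_{s₁} ≅ A.X` on which `W` reads `c`, and a fibre `𝒳_{s₀}` charted by an
abelian `2n`-fold ISOGENOUS to a CM abelian variety generated by one elliptic curve `E₀` with `ψ₀² = -d`
(`cmTowerAnchor`). It is `PointedWeilFamiliesComponent n d δ (cmTowerAnchor n d)` — gen 5's pointed schema with the CM
point NAMED. In print: any polarized abelian variety of Weil type `(X, K, E)` is a member of the connected
`n²`-dimensional family `H_n/Γ_Λ` of polarized abelian varieties of Weil type (van Geemen 5.3, 5.8–5.11), whose
`(V, H)` is classified by `(n, d, det H)` (Landherr, (5.4.1)) so that the CM tower member of class `δ` (part 4,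
`exists_cmMember`) sits in the same family up to isogeny; the Weil section is flat (`Γ ⊂ SU(V, H)`) and lifts to a global
class by the théorème de la partie fixe; Deligne's proof of Thm. 4.8 joins every member to CM members. Weaker than
`IsogenyConnectedWeilComponent` (far end: every member ↦ the CM tower; `…_of_isogenyConnected`), stronger than gen 5's
`CMPointedWeilFamiliesComponent` (`cmPointedWeilFamiliesComponent_of_isogenyConnectedToCMAnchor`), and — unlike the
latter — VALID WITHOUT `HC_CM` (`anchoredWeilFamiliesComponent_of_isogenyConnectedToCMAnchor`). No on-path lemma: under
HC the constant family does not reach the CM tower. OPEN formally (no moduli of Weil type in `Literature/`).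
[cite: vanGeemen1994HodgeAV, Lemma 5.2 (3), 5.3–5.5 and 5.8–5.11] [cite: Deligne1982HodgeCycles, §4, proof of Thm. 4.8 (a)–(c) and §5]
[cite: Markman2025SecantWeil, p. 3 (preprint, unrefereed)] [status: open] -/
@[conjecture] def IsogenyConnectedToCMAnchor (n d : ℕ) (δ : weilNormResidueGroup d) : Prop :=
  PointedWeilFamiliesComponent n d δ (cmTowerAnchor n d)

/-- **N72 ⟹ N73: isogeny-connectedness of the component implies the anchor-pointed leaf** (`n, d ≥ 1`, every `δ`).
Right sign: feed `IsogenyConnectedWeilComponent` the CM tower member of exact class `δ` (part 4, `exists_cmMember`,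
over the curve `E₀ = ℂ/ℤ[√-d]` of `exists_cmCurve_sqrt_neg`); the far fibre is then charted by `A₀'` isogenous to it.
Wrong sign: both leaves are vacuous (part 5). [cite: vanGeemen1994HodgeAV, 4.11, 4.14, 5.3 and Lemma 5.2 (4)] -/
theorem isogenyConnectedToCMAnchor_of_isogenyConnected {n d : ℕ} (hn : 0 < n) (hd : 0 < d)
    {δ : weilNormResidueGroup d} (hI : IsogenyConnectedWeilComponent n d δ) :
    IsogenyConnectedToCMAnchor n d δ := by
  by_cases hδ : weilSign d δ = (-1) ^ n
  · intro A φ hAdim hX hφ e a haQ ha0 hN c hcQ hcH hc hc0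
    obtain ⟨g, hgr, hgnz, hgσ⟩ := exists_segreHyperplaneClasses
    obtain ⟨E₀, ψ₀, hE, hψ⟩ := Literature.NumberTheory.EllipticCurves.CMEndomorphism.exists_cmCurve_sqrt_neg d hd
    obtain ⟨A₀, φ₀, e₀, hW₀, hen₀, hN₀, -, hgen₀, hcm₀⟩ := exists_cmMember g hgr hgnz hgσ hE hd hψ hn hδ
    obtain ⟨𝒳, S, f, s₁, s₀, ι, A₀', W, hiso, hA₀'dim, hι₀, hf, h𝒳, hS, hirr, hsm, hW, hch, hread⟩ :=
      hI A φ hAdim hX hφ e a haQ ha0 hN c hcQ hcH hc hc0 A₀ φ₀ hW₀.dim_eq hW₀.isSmoothProjective hW₀.sq_eq e₀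
        (g e₀.n) (hgr _) (hgnz _ hen₀) hN₀
    exact ⟨𝒳, S, f, s₁, s₀, ι, W, hf, h𝒳, hS, hirr, hsm, hW, hch, hread,
      A₀', hι₀, hA₀'dim, E₀, ψ₀, A₀, hE, hψ, hiso, hcm₀, hgen₀⟩
  · exact pointedWeilFamiliesComponent_of_weilSign_ne hn hd hδ _

/-- **N73 on a wrong-sign index holds outright** (part 5: no member carries a non-zero Weil class).
[cite: vanGeemen1994HodgeAV, 4.14 and Lemma 5.2 (4)] -/
theorem isogenyConnectedToCMAnchor_of_weilSign_ne {n d : ℕ} (hn : 0 < n) (hd : 0 < d)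
    {δ : weilNormResidueGroup d} (h : weilSign d δ ≠ (-1) ^ n) : IsogenyConnectedToCMAnchor n d δ :=
  pointedWeilFamiliesComponent_of_weilSign_ne hn hd h _

/-- **N73 ⟹ gen 5's CM-pointed leaf** (forget the tower, keep the CM type, which passes along the isogeny).
[cite: Milne1999, §2 p. 54] [cite: Deligne1982HodgeCycles, §4, proof of Thm. 4.8 (a)–(c)] -/
theorem cmPointedWeilFamiliesComponent_of_isogenyConnectedToCMAnchor {n d : ℕ} {δ : weilNormResidueGroup d}
    (hP : IsogenyConnectedToCMAnchor n d δ) : CMPointedWeilFamiliesComponent n d δ :=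
  PointedWeilFamiliesComponent.mono (fun _ _ h => cmAnchor_of_cmTowerAnchor h) hP

/-- **N73 ⟹ R∞anc(δ) WITHOUT `HC_CM`** (every `δ`, no sign hypothesis): at the marked fibre the restricted class is
rational of type `(n,n)` (family datum) and the CM-tower anchor is valid by Tate up to isogeny.
[cite: vanGeemen1994HodgeAV, Lemma 3.7, Thm. 4.3 and 5.3–5.5] -/
theorem anchoredWeilFamiliesComponent_of_isogenyConnectedToCMAnchor {n d : ℕ} (hd : 0 < d)
    {δ : weilNormResidueGroup d} (hP : IsogenyConnectedToCMAnchor n d δ) :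
    AnchoredWeilFamiliesComponent n d δ := by
  intro A φ hAdim hX hφ e a haQ ha0 hN c hcQ hcH hc hc0
  obtain ⟨𝒳, S, f, s₁, s₀, ι, W, hf, h𝒳, hS, hirr, hsm, hW, hch, hread, hanch⟩ :=
    hP A φ hAdim hX hφ e a haQ ha0 hN c hcQ hcH hc hc0
  exact ⟨𝒳, S, f, s₁, s₀, ι, W, hf, h𝒳, hS, hirr, hsm, hW, hch, hread,
    cmTowerAnchor_valid n hd _ _ hanch (hW s₀).1 (hW s₀).2⟩

/-! ### §3 The rows re-based on the anchor-pointed leaf -/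

/-- **EVERY CELL from the anchor-pointed leaf and the variational instance** — `n ≥ 0`, `d ≥ 1`, every `δ`, no sign
hypothesis, no `HC_CM`: gen 5's anchor engine with the CM-tower anchor (valid by Tate up to isogeny). The per-cell
residual of the Weil column is ONE anchor-pointed moduli statement plus ONE VHC instance. (Part 4's row
`weilClassesComponent_of_isogenyConnected_of_variational` factors through this one via
`isogenyConnectedToCMAnchor_of_isogenyConnected`; not restated.)
[cite: vanGeemen1994HodgeAV, Lemma 3.7, Thm. 4.3, 5.3–5.5] [cite: CharlesSchnell2014Notes, Conj. 11.3.1]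
[cite: Markman2025SecantWeil, Thm. 1.5.1 (strategy; preprint, unrefereed)] -/
theorem weilClassesComponent_of_isogenyConnectedToCMAnchor_of_variational {n d : ℕ} (hd : 0 < d)
    {δ : weilNormResidueGroup d} (hP : IsogenyConnectedToCMAnchor n d δ)
    (hV : WeilVariationalHodgeComponent n d δ) : WeilClassesComponent n d δ :=
  weilClassesComponent_of_pointed_of_variational (cmTowerAnchor_valid n hd) hP hV

/-- **The anchor-pointed residual pair is implied by the gen-8 residual pair** (per index).
[cite: vanGeemen1994HodgeAV, 5.3–5.5] -/
theorem anchorPointedResidualPair_of_residualPair {n d : ℕ} (hn : 0 < n) (hd : 0 < d) {δ : weilNormResidueGroup d}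
    (h : IsogenyConnectedWeilComponent n d δ ∧ WeilVariationalHodgeComponent n d δ) :
    IsogenyConnectedToCMAnchor n d δ ∧ WeilVariationalHodgeComponent n d δ :=
  ⟨isogenyConnectedToCMAnchor_of_isogenyConnected hn hd h.1, h.2⟩

/-- **The anchor-pointed residual pair on a wrong-sign index holds outright** (part 5).
[cite: vanGeemen1994HodgeAV, Lemma 5.2 (4)] -/
theorem anchorPointedResidualPair_of_weilSign_ne {n d : ℕ} (hn : 0 < n) (hd : 0 < d) {δ : weilNormResidueGroup d}
    (h : weilSign d δ ≠ (-1) ^ n) :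
    IsogenyConnectedToCMAnchor n d δ ∧ WeilVariationalHodgeComponent n d δ :=
  ⟨isogenyConnectedToCMAnchor_of_weilSign_ne hn hd h, weilVariationalHodgeComponent_of_weilSign_ne hn hd h⟩

/-- **The column** `WeilClassesByComponent` from the anchor-pointed pair on the RIGHT-SIGN components (the wrong-sign
components are empty, gen 7). [cite: vanGeemen1994HodgeAV, 4.14, Lemma 5.2 (4), 5.3–5.5] [cite: CharlesSchnell2014Notes, Conj. 11.3.1] -/
theorem weilClassesByComponent_of_anchorPointed_of_variational
    (h : ∀ n : ℕ, 2 ≤ n → ∀ d : ℕ, 0 < d → ∀ δ : weilNormResidueGroup d, weilSign d δ = (-1) ^ n →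
      IsogenyConnectedToCMAnchor n d δ ∧ WeilVariationalHodgeComponent n d δ) :
    WeilClassesByComponent := by
  intro n hn d hd δ
  by_cases hs : weilSign d δ = (-1) ^ n
  · exact weilClassesComponent_of_isogenyConnectedToCMAnchor_of_variational hd (h n hn d hd δ hs).1
      (h n hn d hd δ hs).2
  · exact weilClassesComponent_of_weilSign_ne (by omega) hd hs

/-- **The column, uniformly in the sign** (the wrong-sign entries of the supply are theorems).
[cite: vanGeemen1994HodgeAV, Lemma 5.2 (4), 5.3–5.5] [cite: CharlesSchnell2014Notes, Conj. 11.3.1] -/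
theorem weilClassesByComponent_of_forall_anchorPointed_and_variational
    (h : ∀ n : ℕ, 2 ≤ n → ∀ d : ℕ, 0 < d → ∀ δ : weilNormResidueGroup d,
      IsogenyConnectedToCMAnchor n d δ ∧ WeilVariationalHodgeComponent n d δ) :
    WeilClassesByComponent :=
  fun n _ d hd δ => weilClassesComponent_of_isogenyConnectedToCMAnchor_of_variational hd (h n ‹_› d hd δ).1
    (h n ‹_› d hd δ).2

/-- **THE FLOOR with the anchor-pointed per-cell residual.** `HC` for every complex abelian variety of dimension
`≤ 5` from FOUR refereed print facts (Moonen–Zarhin 1999, Koike 2004, Schoen 1998, Markman 2023; Landherr is ab-weil-2's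
tree theorem, part 6) and, for each positive non-split squarefree fourfold cell `(2, d₀, δ)` (`d₀ ∉ {1, 3}` squarefree,
`δ ≠ [1]`, `sign δ = +1`), the pair `IsogenyConnectedToCMAnchor 2 d₀ δ ∧ WeilVariationalHodgeComponent 2 d₀ δ` — one
anchor-pointed moduli statement and one VHC instance per cell; no `HC_CM`.
[cite: MoonenZarhin1999, Thm. 0.1] [cite: Markman2023GeneralizedKummers, Thm. 1.5] [cite: vanGeemen1994HodgeAV, (5.4.1), 5.3, 5.8–5.11]
[cite: CharlesSchnell2014Notes, Conj. 11.3.1] -/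
theorem hodgeConjectureFor_abelian_dim_le_five_of_refereed_anchorPointed_variational_L
    (hred : MoonenZarhin1999_hodgeClasses_abelian_dim_le_five_of_weilClassesFourfolds)
    (hK : Koike2004_weilClasses_algebraic_hyperbolicSixfold_one)
    (hS : Schoen1998_weilClasses_algebraic_hyperbolicSixfold_three)
    (hM23 : Markman2023_weilClasses_algebraic_discOneWeilFourfold)
    (hCV : ∀ d : ℕ, 0 < d → Squarefree d → d ≠ 1 → d ≠ 3 → ∀ δ : weilNormResidueGroup d,
      δ ≠ splitDiscriminantClass 2 d → weilSign d δ = 1 →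
        IsogenyConnectedToCMAnchor 2 d δ ∧ WeilVariationalHodgeComponent 2 d δ)
    (A : AbelianVariety ℂ) (hA : A.dim ≤ 5) : HodgeConjectureFor A.dim A.X :=
  hodgeConjectureFor_abelian_dim_le_five_of_refereed_and_positive_residualSq_L hred hK hS hM23
    (fun d hd hsq h1 h3 δ hns hδ =>
      weilClassesComponent_of_isogenyConnectedToCMAnchor_of_variational hd (hCV d hd hsq h1 h3 δ hns hδ).1
        (hCV d hd hsq h1 h3 δ hns hδ).2) A hA

/-- **The floor fed uniformly in the sign** (negative non-split squarefree fourfold cells are theorems, part 5).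
[cite: MoonenZarhin1999, Thm. 0.1] [cite: vanGeemen1994HodgeAV, Lemma 5.2 (4), 5.3, 5.8–5.11] [cite: CharlesSchnell2014Notes, Conj. 11.3.1] -/
theorem hodgeConjectureFor_abelian_dim_le_five_of_refereed_anchorPointed_variational_L'
    (hred : MoonenZarhin1999_hodgeClasses_abelian_dim_le_five_of_weilClassesFourfolds)
    (hK : Koike2004_weilClasses_algebraic_hyperbolicSixfold_one)
    (hS : Schoen1998_weilClasses_algebraic_hyperbolicSixfold_three)
    (hM23 : Markman2023_weilClasses_algebraic_discOneWeilFourfold)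
    (hCV : ∀ d : ℕ, 0 < d → Squarefree d → d ≠ 1 → d ≠ 3 → ∀ δ : weilNormResidueGroup d,
      δ ≠ splitDiscriminantClass 2 d →
        IsogenyConnectedToCMAnchor 2 d δ ∧ WeilVariationalHodgeComponent 2 d δ)
    (A : AbelianVariety ℂ) (hA : A.dim ≤ 5) : HodgeConjectureFor A.dim A.X :=
  hodgeConjectureFor_abelian_dim_le_five_of_refereed_anchorPointed_variational_L hred hK hS hM23
    (fun d hd hsq h1 h3 δ hns _ => hCV d hd hsq h1 h3 δ hns) A hA

/-! ### §4 The CM tower is a point of the anchor-pointed leaf's far end (the anchor is NOT vacuous on right-sign cells) -/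

/-- **On every right-sign cell the CM-tower anchor is met by a polarized member OF THE CELL** (exact class `δ`):
the named far end of N73 exists in the cell, so the leaf asks for a path inside the component, not for a member the
component might lack. UNCONDITIONAL. [cite: vanGeemen1994HodgeAV, 4.11, 4.14 and 5.3] -/
theorem cmTowerAnchor_met_in_cell {n d : ℕ} (hn : 0 < n) (hd : 0 < d) {δ : weilNormResidueGroup d}
    (hδ : weilSign d δ = (-1) ^ n) :
    ∃ (A : AbelianVariety ℂ) (φ : A ⟶ A) (e : ProjectiveEmbedding A.X) (a : complexBetti (projectiveSpace e.n ℂ) 2),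
      A.dim = 2 * n ∧ IsSmoothProjective (2 * n) A.X ∧ φ ≫ φ = -(d • 𝟙 A) ∧ IsRationalClass a ∧ a ≠ 0 ∧
        HasWeilDiscriminantNondeg A φ n d
          ((d : ℂ) • complexBetti.map e.ι 2 a + complexBetti.map φ.hom.hom.hom 2 (complexBetti.map e.ι 2 a)) δ ∧
        IsWeilType A φ n d ∧ ∀ x : complexBetti A.X (2 * n), cmTowerAnchor n d A.X x := by
  obtain ⟨g, hgr, hgnz, hgσ⟩ := exists_segreHyperplaneClasses
  obtain ⟨E₀, ψ₀, hE, hψ⟩ := Literature.NumberTheory.EllipticCurves.CMEndomorphism.exists_cmCurve_sqrt_neg d hd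
  obtain ⟨A, φ, e, hW, hen, hN, -, hgen, hcm⟩ := exists_cmMember g hgr hgnz hgσ hE hd hψ hn hδ
  exact ⟨A, φ, e, g e.n, hW.dim_eq, hW.isSmoothProjective, hW.sq_eq, hgr _, hgnz _ hen, hN, hW,
    cmTowerAnchor_self hW.dim_eq hE hψ hcm hgen⟩

end Summit.HodgeConjecture.HodgeConjecture.Ring2.AbelianAll

end
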